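import Summits.Langlands.Langlands.Theses.RepeatedRootSocle
import Literature.NumberTheory.GaloisRepresentations.IntegralGaloisActionProofs

/-!
# Disproof of `PadicLimitUnrefinedR` — findings: NO KILL; the crux survives the birth attacks;
# its content starts at precision `p²` (levels `m ≤ 1` are free)

Refuter crux-attack at birth (unit `rattack-stmt-Langlands-18145`, item stmt-Langlands-18145,
route `route-Langlands-RepeatedRootSocle` rev 5, 2026-08-17).  This is the REPAIRED crux
(multiplier `ε`, homological convention `ρ ≈ V_p A`); the rev-≤4 `PadicLimitUnrefined` was
vacuous (`Cruxes/PadicLimitUnrefined/Disproof.lean`, multiplier `ε⁻¹` against an integral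
arithmetic-Frobenius polynomial).  On the repaired item the old determinant test passes
(`det ρ = ε²` from `Sympl`, `= ε²` on `Γ_{ℚ_p}` from `PSh`, `det ρ(Frob_v) = q_v² = P(0)` from
`Pure`), the hypothesis bracket is satisfiable on paper (`ρ = ρ₀ = V_p(A)` of a modular
`p`-ordinary abelian surface with large residual image), and the conclusion is predicted by
Fontaine–Mazur + reciprocity (an irreducible `P`-ordinary — hence semistable (Perrin-Riou 1994) —
a.e.-unramified `ρ` is automorphic, so `ρ_m := ρ`); no finite model, no cheap falsifier.

Kernel-checked content of this file (all POSITIVE information for the prover; nothing here is a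
refutation or a Theorems landing; axioms `propext`, `Classical.choice`, `Quot.sound`):

* `padicLimitUnrefinedR_of_unrefinedWeightTwoLiftingR` — restates probe `target → crux`: the
  repaired target `UnrefinedWeightTwoLiftingR` implies the crux trivially (`ρ_m := ρ`), so the
  crux is a genuine WEAKENING of the target (the converse direction is the heart
  `LimitClassicalUnrefinedR`; `closes` composes them).
* `eq_map_int_of_hasFrobCharpolyAt` — an `𝒪`-integral Frobenius polynomial that is also the image
  of a `ℤ`-polynomial IS that `ℤ`-polynomial (uniqueness of `HasFrobCharpolyAt` at a place of a
  number field: a prime above `v` and an arithmetic Frobenius at it exist —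
  `primesAbove_nonempty`, `exists_isArithFrobAt_of_mem_primesAbove_holds`).
* `frobCharpoly_cong_mod_p` — from the integrality halves of `Pure ρ₀`, `Pure ρ` and from
  `Cong ρ₀ ρ` (congruence through an ARBITRARY ring map `red : 𝒪 → k`, `k` of characteristic
  `p`; note `ker red = 𝔪_𝒪 ⊋ p𝒪`): the Frobenius polynomials of `ρ` and `ρ₀` are congruent
  modulo `p` itself, coefficientwise, at almost every place — both are `ℤ`-polynomials and
  `ℤ ∩ ker red = pℤ` (`CharP.intCast_eq_intCast`).
* `padicLimitUnrefinedR_iff_fromTwo` — consequently the `Lim` conclusion at precision `m ≤ 1` is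
  FREE (witness `ρ_m := ρ₀`, automorphic by hypothesis `Aut ρ₀`): the crux is EQUIVALENT to its
  restriction `PadicLimitUnrefinedRFromTwo` to `m ≥ 2`.  The first non-trivial instance is a
  congruence modulo `p²` between `ρ` and SOME automorphic `ρ₂` at almost all places.

Paper findings (details in the item's check note): quantifier order matches the informal text
(`∀ m ∃ ρ_m ∀ᶠ v`; the exceptional set may depend on `m` — weaker than a fixed tame level, so the
crux is slightly easier and the heart correspondingly stronger); `red` is forced to have kernel
`𝔪_𝒪` (rank-one valuation ring, `p ∈ ker`), so `Cong`/`BigRes` mean "mod `𝔪`" as intended;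
`Aut` uses Buzzard–Gee's L-normalisation `∏ (X - ι⁻¹(a_j⁻¹))` (= the summit's
`SatakeFrobCompatibleAt`), met on paper by `π_A ⊗ |det|^{1/2}` (L-algebraic, `n = 4` even);
`ρ.IsIrreducible` is implied by `BigRes ρ` (Brauer–Nesbitt), `p ≠ 2`, `BigRes`, and every
hypothesis on `ρ₀` are provability (Taylor–Wiles) hypotheses, not needed for truth under FM+L;
the a.e.-unramified half of `Pure ρ` is load-bearing for the typed `Lim` (infinitely ramified
`ρ` à la Ramakrishna have no Frobenius polynomial at infinitely many `v`).  `S → C` holds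
modulo "P-ordinary ⇒ `IsDeRhamFramed` for Fontaine's pinned datum" (not in the tree); `C → S`
does not (one sector, limit only).
-/

set_option linter.dupNamespace false

open scoped NumberField Polynomial
open IsDedekindDomain Field Filter
open Literature.NumberTheory.GaloisRepresentations
open Summit.Langlands.Langlands.Theses.RepeatedRootSocle

namespace Summit.Langlands.Langlands.Cruxes.PadicLimitUnrefinedR.Disproof

/-- Restates probe `target → crux`: `UnrefinedWeightTwoLiftingR → PadicLimitUnrefinedR`
(take `ρ_m := ρ`, automorphic by the target, and `P = P'`). [folklore] -/
theorem padicLimitUnrefinedR_of_unrefinedWeightTwoLiftingR (hS : UnrefinedWeightTwoLiftingR) :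
    PadicLimitUnrefinedR := by
  intro p _ hp k _ _ _ _ _ red hcpt ι R4 Pl ρ₀ ρ Sympl PSh Pure Cong BigRes Aut Lim
    h1 h2 h3 h4 h5 h6 h7 h8 h9 h10 h11 m
  have hA : Aut ρ := hS p hp k red hcpt ι ρ₀ ρ h1 h2 h3 h4 h5 h6 h7 h8 h9 h10 h11
  refine ⟨ρ, hA, ?_⟩
  filter_upwards [h11] with v hv
  obtain ⟨P, P', -, hP', -⟩ := hv
  exact ⟨P', P', hP', hP', fun i => by simp⟩

variable {p : ℕ} [Fact p.Prime]

/-- An `𝒪_{ℚ̄_p}`-integral Frobenius characteristic polynomial at a place `v` of `ℚ` which is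
also (the image of) a `ℤ`-polynomial is that `ℤ`-polynomial: `HasFrobCharpolyAt` pins the
polynomial because a prime above `v` and an arithmetic Frobenius at it exist
(`primesAbove_nonempty`, `exists_isArithFrobAt_of_mem_primesAbove_holds`). [folklore] -/
theorem eq_map_int_of_hasFrobCharpolyAt {n : ℕ} (ρ : FramedGaloisRep ℚ (PadicAlgCl p) n)
    (v : HeightOneSpectrum (𝓞 ℚ)) {P : Polynomial (Valued.integer (PadicAlgCl p))} {Q : ℤ[X]}
    (hP : ρ.HasFrobCharpolyAt v (P.map (Valued.integer (PadicAlgCl p)).subtype))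
    (hQ : ρ.HasFrobCharpolyAt v (Q.map (Int.castRingHom (PadicAlgCl p)))) :
    P = Q.map (Int.castRingHom (Valued.integer (PadicAlgCl p))) := by
  obtain ⟨𝔓, h𝔓⟩ := v.primesAbove_nonempty
  obtain ⟨σ, hσ⟩ := HeightOneSpectrum.exists_isArithFrobAt_of_mem_primesAbove_holds h𝔓
  have h1 := hP 𝔓 h𝔓 σ hσ
  have h2 := hQ 𝔓 h𝔓 σ hσ
  apply Polynomial.map_injective (Valued.integer (PadicAlgCl p)).subtype Subtype.val_injective
  have hc : ((Valued.integer (PadicAlgCl p)).subtype.comp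
      (Int.castRingHom (Valued.integer (PadicAlgCl p)))) = Int.castRingHom (PadicAlgCl p) :=
    RingHom.ext_int _ _
  rw [← h1, h2, Polynomial.map_map, hc]

/-- **Frobenius polynomials congruent through `red` are congruent modulo `p`.**  If `ρ₀`, `ρ`
have `ℤ`-integral Frobenius polynomials a.e. (the integrality half of the route's `Pure`) and
`𝒪`-integral Frobenius polynomials with equal images under some ring map `red : 𝒪 → k` into a
ring of characteristic `p` a.e. (the route's `Cong ρ₀ ρ`), then a.e. the (`𝒪`-integral)
Frobenius polynomials of `ρ` and `ρ₀` are congruent modulo `p` coefficientwise. [folklore] -/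
theorem frobCharpoly_cong_mod_p {k : Type} [Field k] [CharP k p]
    (red : Valued.integer (PadicAlgCl p) →+* k) (ρ₀ ρ : FramedGaloisRep ℚ (PadicAlgCl p) 4)
    (hPure₀ : ∀ᶠ v : HeightOneSpectrum (𝓞 ℚ) in cofinite, ρ₀.IsUnramifiedAt v ∧
      ∃ P : ℤ[X], ρ₀.HasFrobCharpolyAt v (P.map (Int.castRingHom (PadicAlgCl p))) ∧
        ∀ z : ℂ, (P.map (Int.castRingHom ℂ)).IsRoot z → ‖z‖ ^ 2 = (v.residueCard : ℝ))
    (hPure : ∀ᶠ v : HeightOneSpectrum (𝓞 ℚ) in cofinite, ρ.IsUnramifiedAt v ∧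
      ∃ P : ℤ[X], ρ.HasFrobCharpolyAt v (P.map (Int.castRingHom (PadicAlgCl p))) ∧
        ∀ z : ℂ, (P.map (Int.castRingHom ℂ)).IsRoot z → ‖z‖ ^ 2 = (v.residueCard : ℝ))
    (hCong : ∀ᶠ v : HeightOneSpectrum (𝓞 ℚ) in cofinite,
      ∃ P P' : Polynomial (Valued.integer (PadicAlgCl p)),
        ρ₀.HasFrobCharpolyAt v (P.map (Valued.integer (PadicAlgCl p)).subtype) ∧
        ρ.HasFrobCharpolyAt v (P'.map (Valued.integer (PadicAlgCl p)).subtype) ∧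
        P.map red = P'.map red) :
    ∀ᶠ v : HeightOneSpectrum (𝓞 ℚ) in cofinite,
      ∃ P P' : Polynomial (Valued.integer (PadicAlgCl p)),
        ρ.HasFrobCharpolyAt v (P.map (Valued.integer (PadicAlgCl p)).subtype) ∧
        ρ₀.HasFrobCharpolyAt v (P'.map (Valued.integer (PadicAlgCl p)).subtype) ∧
        ∀ i : ℕ, ((p : ℕ) : Valued.integer (PadicAlgCl p)) ∣ (P - P').coeff i := by
  filter_upwards [hPure₀, hPure, hCong] with v hv₀ hv hc
  obtain ⟨-, Q₀, hQ₀, -⟩ := hv₀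
  obtain ⟨-, Q, hQ, -⟩ := hv
  obtain ⟨P₀, P, hP₀, hP, hred⟩ := hc
  obtain rfl : P = Q.map (Int.castRingHom _) := eq_map_int_of_hasFrobCharpolyAt ρ v hP hQ
  obtain rfl : P₀ = Q₀.map (Int.castRingHom _) := eq_map_int_of_hasFrobCharpolyAt ρ₀ v hP₀ hQ₀
  refine ⟨_, _, hP, hP₀, fun i => ?_⟩
  have hci : ((Q₀.coeff i : ℤ) : k) = ((Q.coeff i : ℤ) : k) := by
    have h := congrArg (fun R : Polynomial k => R.coeff i) hred
    simpa [Polynomial.coeff_map] using h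
  have hdvd : (p : ℤ) ∣ Q.coeff i - Q₀.coeff i := ((CharP.intCast_eq_intCast k p).mp hci).dvd
  have h := map_dvd (Int.castRingHom (Valued.integer (PadicAlgCl p))) hdvd
  simpa [Polynomial.coeff_map] using h

/-- The crux with its conclusion `Lim ρ` restricted to precision `m ≥ 2` (everything else
byte-identical to `PadicLimitUnrefinedR`, rev 5 of the route file). -/
def PadicLimitUnrefinedRFromTwo : Prop :=
  ∀ (p : ℕ) [Fact p.Prime], p ≠ 2 → ∀ (k : Type) [Field k] [CharP k p] [IsAlgClosed k] [TopologicalSpace k] [DiscreteTopology k] (red : Valued.integer (PadicAlgCl p) →+* k) (hcpt : Literature.NumberTheory.Automorphic.isCompact_glFiniteIntegralLevel 4 ℚ) (ι : PadicAlgCl p ≃+* ℂ), let R4 := Literature.NumberTheory.GaloisRepresentations.FramedGaloisRep ℚ (PadicAlgCl p) 4; let Pl := IsDedekindDomain.HeightOneSpectrum (NumberField.RingOfIntegers ℚ); ∀ (ρ₀ ρ : R4), let Sympl := fun r : R4 => r.IsSymplecticWithMultiplierFun (fun g => algebraMap ℚ_[p] (PadicAlgCl p) (((Literature.NumberTheory.GaloisRepresentations.GaloisRep.cyclotomicCharacter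 ℚ p g : ℤ_[p]ˣ) : ℤ_[p]) : ℚ_[p])); let PSh := fun (r : R4) (v : Pl) => ∃ (g : Matrix.GeneralLinearGroup (Fin 4) (PadicAlgCl p)) (α β : Field.absoluteGaloisGroup (v.adicCompletion ℚ) →* (PadicAlgCl p)ˣ), (∀ τ ∈ Literature.NumberTheory.GaloisRepresentations.absInertia (v.adicCompletion ℚ), α τ = 1 ∧ β τ = 1) ∧ ∀ τ, (∀ i j : Fin 4, j < i → (g⁻¹ * r.toLocal v τ * g).val i j = 0) ∧ (g⁻¹ * r.toLocal v τ * g).val 0 1 = 0 ∧ (g⁻¹ * r.toLocal v τ * g).val 2 3 = 0 ∧ (g⁻¹ * r.toLocal v τ * g).val 0 0 = algebraMap ℚ_[p] (PadicAlgCl p) (((Literature.NumberTheory.GaloisRepresentations.GaloisRep.cyclotomicCharacter (v.adicCompletion ℚ) p τ : ℤ_[p]ˣ) : ℤ_[p]) : ℚ_[p]) * α τ ∧ (g⁻¹ * r.toLocal v τ * g).val 1 1 = algebraMap ℚ_[p] (PadicAlgCl p) (((Literature.NumberTheory.GaloisRepresentations.GaloisRep.cyclotomicCharacter (v.adicCompletion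 ℚ) p τ : ℤ_[p]ˣ) : ℤ_[p]) : ℚ_[p]) * β τ ∧ (g⁻¹ * r.toLocal v τ * g).val 2 2 = ((β τ)⁻¹ : (PadicAlgCl p)ˣ) ∧ (g⁻¹ * r.toLocal v τ * g).val 3 3 = ((α τ)⁻¹ : (PadicAlgCl p)ˣ); let Pure := fun r : R4 => ∀ᶠ v : Pl in Filter.cofinite, r.IsUnramifiedAt v ∧ ∃ P : Polynomial ℤ, r.HasFrobCharpolyAt v (P.map (Int.castRingHom (PadicAlgCl p))) ∧ ∀ z : ℂ, (P.map (Int.castRingHom ℂ)).IsRoot z → ‖z‖ ^ 2 = (v.residueCard : ℝ); let Cong := fun r r' : R4 => ∀ᶠ v : Pl in Filter.cofinite, ∃ P P' : Polynomial (Valued.integer (PadicAlgCl p)), r.HasFrobCharpolyAt v (P.map (Valued.integer (PadicAlgCl p)).subtype) ∧ r'.HasFrobCharpolyAt v (P'.map (Valued.integer (PadicAlgCl p)).subtype) ∧ P.map red = P'.map red; let BigRes := fun r : R4 => ∃ σ : Literature.NumberTheory.GaloisRepresentations.FramedGaloisRep ℚ k 4, (∀ᶠ v : Pl in Filter.cofinite,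 ∃ (P : Polynomial (Valued.integer (PadicAlgCl p))) (Pb : Polynomial k), r.HasFrobCharpolyAt v (P.map (Valued.integer (PadicAlgCl p)).subtype) ∧ σ.HasFrobCharpolyAt v Pb ∧ P.map red = Pb) ∧ σ.toGaloisRep.IsIrreducible ∧ ∃ x, ((σ x).val.charpoly).Separable; let Aut := fun r : R4 => ∃ π : Literature.NumberTheory.Automorphic.CuspidalAutomorphicRepData 4 ℚ hcpt, π.1.IsLAlgebraic ∧ ∀ᶠ v : Pl in Filter.cofinite, ∃ a : Multiset ℂ, π.1.HasSatakeParamAt v a ∧ r.IsUnramifiedAt v ∧ r.HasFrobCharpolyAt v (Literature.NumberTheory.Automorphic.arithFrobPolyOfSatake ι v.residueCard 1 a); let Lim := fun r : R4 => ∀ m : ℕ, 2 ≤ m → ∃ r' : R4, Aut r' ∧ ∀ᶠ v : Pl in Filter.cofinite, ∃ P P' : Polynomial (Valued.integer (PadicAlgCl p)), r.HasFrobCharpolyAt v (P.map (Valued.integer (PadicAlgCl p)).subtype) ∧ r'.HasFrobCharpolyAt v (P'.map (Valued.integer (PadicAlgCl p)).subtype) ∧ ∀ i : ℕ, ((p :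 ℕ) : Valued.integer (PadicAlgCl p)) ^ m ∣ (P - P').coeff i; ρ₀.toGaloisRep.IsIrreducible → Sympl ρ₀ → (∀ v : Pl, ((p : ℕ) : NumberField.RingOfIntegers ℚ) ∈ v.asIdeal → PSh ρ₀ v) → Pure ρ₀ → Aut ρ₀ → ρ.toGaloisRep.IsIrreducible → Sympl ρ → (∀ v : Pl, ((p : ℕ) : NumberField.RingOfIntegers ℚ) ∈ v.asIdeal → PSh ρ v) → Pure ρ → BigRes ρ → Cong ρ₀ ρ → Lim ρ

/-- **The content of the crux starts at `p²`:** `PadicLimitUnrefinedR` is equivalent to its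
restriction to precisions `m ≥ 2`; at `m ≤ 1` the automorphic `ρ₀` itself is the witness
(`frobCharpoly_cong_mod_p`). [folklore] -/
theorem padicLimitUnrefinedR_iff_fromTwo : PadicLimitUnrefinedR ↔ PadicLimitUnrefinedRFromTwo := by
  constructor
  · intro h p _ hp k _ _ _ _ _ red hcpt ι R4 Pl ρ₀ ρ Sympl PSh Pure Cong BigRes Aut Lim
      h1 h2 h3 h4 h5 h6 h7 h8 h9 h10 h11 m _
    exact h p hp k red hcpt ι ρ₀ ρ h1 h2 h3 h4 h5 h6 h7 h8 h9 h10 h11 m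
  · intro h p _ hp k _ _ _ _ _ red hcpt ι R4 Pl ρ₀ ρ Sympl PSh Pure Cong BigRes Aut Lim
      h1 h2 h3 h4 h5 h6 h7 h8 h9 h10 h11 m
    rcases Nat.lt_or_ge m 2 with hm | hm
    · refine ⟨ρ₀, h5, ?_⟩
      filter_upwards [frobCharpoly_cong_mod_p red ρ₀ ρ h4 h9 h11] with v hv
      obtain ⟨P, P', hP, hP', hd⟩ := hv
      refine ⟨P, P', hP, hP', fun i => ?_⟩
      interval_cases m
      · simp
      · simpa using hd i
    · exact h p hp k red hcpt ι ρ₀ ρ h1 h2 h3 h4 h5 h6 h7 h8 h9 h10 h11 m hm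

end Summit.Langlands.Langlands.Cruxes.PadicLimitUnrefinedR.Disproof
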